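import Literature.Probability.LatticeModels.ImprovedTreeDiagramBound
import Literature.Probability.LatticeModels.HighDimPointwiseTriviality
import HarnessLib

/-!
# The improved tree diagram bound: passage from finite volume to the DLR states (Aizenman–Duminil-Copin 2021, Thm 1.3)

Topic `Literature/Probability/LatticeModels`; family `crit-ising` (crit-ising.S13). Theorems only:
no definition and no named fact is introduced.

The named fact `aizenmanDuminilCopin_improvedTreeDiagramBound` (`ImprovedTreeDiagramBound.lean`;
M. Aizenman, H. Duminil-Copin, *Marginal triviality of the scaling limits of critical 4D Ising and
`φ⁴₄` models*, Ann. of Math. **194** (2021) = arXiv:1912.07973, **Theorem 1.3**, p. 6) is a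
statement about the infinite-volume states `μ ∈ 𝒢(β, 0)` of `ℤ⁴`, `β ≤ β_c`, whereas the
random-current machinery through which the paper proves it (§3–§4, §6.1–6.2; in the tree:
`ClusteringToTreeBound`, `AnnularCovering`, `CurrentsDisentangling`, `IntersectionSourceSwitch`,
`IntersectionSecondMoment`, `BubbleScaleSequence`, …) lives on FINITE graphs. The paper itself
works with weak limits of random-current measures ("Existing continuity results [AizDumSid15]
permit to extend (3.4) to the infinite volume", §3.2, p. 9, with the footnote on the
infinite-volume switching lemma); the tree instead passes to the limit at the level of
correlation functions, as it already does for the plain tree diagram bound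
(`abs_connectedFour_le_treeSum_free`, `HighDimTrivialityUniformProofs`, Part 8). This file
provides that passage for an IMPROVED bound, i.e. one whose gain over the tree diagram bound is
only available in the bulk of the finite volume:

* `abs_connectedFour_le_of_finiteVolume_free` — **thermodynamic limit of a four-point bound with
  a vanishing boundary layer.** Let `μ` be the translation-invariant free state at `β ≥ 0` (any
  `d`) and `x₁,…,x₄ ∈ ℤ^d`. If for all large `N` the free state of the box `Λ_N` satisfies
  `|U₄^{Λ_N}(x)| ≤ A ∑_{u ∈ Λ_N} ∏ⱼ ⟨σ_uσ_{xⱼ}⟩_{Λ_N} + E ∑_{u ∈ Λ_N, ‖u‖ > N-R} ∏ⱼ ⟨σ_uσ_{xⱼ}⟩_{Λ_N}`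
  with constants `A, E ≥ 0` and a boundary layer of fixed width `R`, and if
  `u ↦ ∏ⱼ ⟨σ_uσ_{xⱼ}⟩_μ` is summable, then `|U₄^μ(x)| ≤ A ∑_u ∏ⱼ ⟨σ_uσ_{xⱼ}⟩_μ`: the left side
  converges along boxes (`hasBoxLimit_isingCorr_free_holds`), the bulk term is dominated by the
  infinite-volume series through `0 ≤ ⟨σ_uσ_x⟩^∅_Λ ≤ ⟨σ₀σ_{x-u}⟩^∅_β` (Griffiths, volume
  monotonicity, translation covariance — theorems of the tree), and the boundary-layer term is at
  most `E` times a tail of the convergent series, which tends to `0`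
  (`tendsto_tsum_sub_sum_box_atTop`, `sum_filter_lt_supNorm_le_tsum_sub`);
* `abs_connectedFour_le_of_finiteVolume_of_hasUniqueGibbsMeasure`,
  `abs_connectedFour_le_of_finiteVolume_three_le` — the same for every `μ ∈ 𝒢(β, 0)` at a point
  of uniqueness, in particular for `d ≥ 3`, `0 ≤ β ≤ β_c` (`hasUniqueGibbsMeasure_of_lt_criticalBeta_holds`,
  `hasUniqueGibbsMeasure_criticalBeta_holds`, `exists_freeMeasure_holds`);
* `aizenmanDuminilCopin_improvedTreeDiagramBound_of_finiteVolume` — **Theorem 1.3 from its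
  finite-volume bulk form.** If there are `c, C > 0` and `L₀` such that for `0 ≤ β ≤ β_c(4)`,
  `L ≥ L₀` in the window `L ≤ ξ(β)` and `x₁,…,x₄` at mutual sup-distance `> L`, the free states of
  the boxes `Λ_N` eventually satisfy the displayed bound with `A = C / B_L(β)^c`
  (`B_L(β) = bubbleDiagram (twoPointFree 4 β) L`, the infinite-volume bubble diagram) and some
  boundary layer `R`, `E`, then `aizenmanDuminilCopin_improvedTreeDiagramBound` holds: large scales
  by the transfer, the scales `L < max(L₀, 1)` by the plain tree diagram bound
  (`aizenman_treeDiagramBound_three_le`, a theorem of the tree) and `1 ≤ B_L ≤ |Λ_{max(L₀,1)}|`.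

The finite-volume bulk form is what the finite-graph line of the tree produces: the §4.1
reduction `Current.ursellInter_mul_sq_le` (`ClusteringToTreeBound`) bounds `|U₄^{Λ_N}|` by
`2 ∑_u ∏ⱼ⟨σ_uσ_{xⱼ}⟩_{Λ_N} (P_u[M_u < 7r] + 2^{-r})`, the intersection-clustering bound (ADC
Prop. 6.1) makes `P_u` small for `u` in the bulk (where the finite-volume two-point function is
comparable with the regular infinite-volume one on the scales `≤ ℓ_K ≤ L`), and for `u` within a
bounded distance `R = R(L)` of `∂Λ_N` one only has `P_u ≤ 1`, which is the boundary-layer term with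
`E = 4`; it disappears in the limit `N → ∞` by the present file.

## References

* M. Aizenman, H. Duminil-Copin, Ann. of Math. 194 (2021), arXiv:1912.07973: Theorem 1.3 (p. 6);
  §3.2, (3.4)–(3.5) and footnote 5 (infinite-volume random currents, p. 9); §4.1 and §6.1
  (proof of Theorem 1.3) [AizenmanDuminilCopinAnnals2021].
* M. Aizenman, Commun. Math. Phys. 86 (1982) (tree diagram bound for infinite-volume limits of
  finite systems); S. Friedli, Y. Velenik, *Statistical Mechanics of Lattice Systems* (2017),
  Exercise 3.16, Thm. 3.17 (thermodynamic limit of the free state) [FriedliVelenik2017].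

## Mathlib

`Filter.Tendsto` algebra, `le_of_tendsto_of_tendsto`, `Filter.tendsto_sub_atTop_nat`,
`Summable.sum_le_tsum`, `Real.rpow_le_rpow`, `Real.rpow_pos_of_pos`.
-/

noncomputable section

open MeasureTheory Filter Topology Finset
open Literature.Probability.LatticeModels Literature.Probability.Percolation

namespace Literature.Probability.LatticeModels

variable {d : ℕ}

/-! ### Part 1. Thermodynamic limit of a four-point bound with a vanishing boundary layer -/

/-- **Thermodynamic limit of a four-point bound with a vanishing boundary layer (free state).**
Let `μ` be a translation-invariant probability measure on `{±1}^{ℤ^d}` whose correlations are the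
free box limits `⟨σ_A⟩^∅_{β,0}` (`β ≥ 0`), and `x₁,…,x₄ ∈ ℤ^d`. Suppose that for all large `N`
the free finite-volume state of `Λ_N` satisfies
`|U₄^{Λ_N}(x)| ≤ A ∑_{u ∈ Λ_N} ∏ⱼ ⟨σ_uσ_{xⱼ}⟩_{Λ_N} + E ∑_{u ∈ Λ_N, ‖u‖_∞ > N - R} ∏ⱼ ⟨σ_uσ_{xⱼ}⟩_{Λ_N}`
with `A, E ≥ 0` and a fixed `R`. If `u ↦ ∏ⱼ ⟨σ_uσ_{xⱼ}⟩_μ` is summable then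
`|U₄^μ(x)| ≤ A ∑_u ∏ⱼ ⟨σ_uσ_{xⱼ}⟩_μ`. (The passage to infinite volume of Aizenman 1982 /
Aizenman–Duminil-Copin 2021, §3.2, done at the level of correlation functions: box limits on the
left, volume monotonicity `0 ≤ ⟨σ_uσ_x⟩^∅_Λ ≤ ⟨σ₀σ_{x-u}⟩^∅_β` on the right, and the boundary
layer is a tail of the convergent series.) [cite: AizenmanDuminilCopinAnnals2021, arXiv:1912.07973 §3.2, (3.4)–(3.5) with footnote 5 (p. 9), and §4.1/§6.1, proof of Thm 1.3] -/
theorem abs_connectedFour_le_of_finiteVolume_free {β : ℝ} (hβ : 0 ≤ β)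
    (μ : Measure (SpinConfig (Site d))) [IsProbabilityMeasure μ]
    (hTI : IsTranslationInvariantMeasure μ)
    (hcorr : ∀ A : Finset (Site d), spinCorr μ A = freeCorr d β 0 A)
    (x : Fin 4 → Site d) {A E : ℝ} (hA : 0 ≤ A) (hE : 0 ≤ E) (R : ℕ)
    (hfin : ∀ᶠ N : ℕ in atTop,
      |connectedFour (isingMeasure (zdGraph d) (box d N) β 0 .free) spinAt x| ≤
        A * ∑ u ∈ box d N, ∏ j, isingTwoPoint (zdGraph d) (box d N) β 0 .free u (x j) +
        E * ∑ u ∈ (box d N).filter (fun u => N - R < Site.supNorm u),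
              ∏ j, isingTwoPoint (zdGraph d) (box d N) β 0 .free u (x j))
    (hsum : Summable fun u : Site d => ∏ i, twoPoint μ spinAt u (x i)) :
    |connectedFour μ spinAt x| ≤ A * ∑' u : Site d, ∏ i, twoPoint μ spinAt u (x i) := by
  classical
  -- box limits of spin monomials in the free state: `∏ᵢ σ_{zᵢ} = σ_A`, `A` = sites of odd
  -- multiplicity (`σ_z² = 1`), and `⟨σ_A⟩^∅_{Λ_L} → freeCorr d β 0 A = ∫ σ_A dμ`
  have hmon : ∀ {n : ℕ} (z : Fin n → Site d),
      Tendsto (fun L : ℕ => ∫ σ, ∏ i, spinAt (z i) σ ∂isingMeasure (zdGraph d) (box d L) β 0 .free)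
        atTop (𝓝 (∫ σ, ∏ i, spinAt (z i) σ ∂μ)) := by
    intro n z
    obtain ⟨A, hA⟩ : ∃ A : Finset (Site d), ∀ σ : SpinConfig (Site d),
        ∏ i, spinAt (z i) σ = spinProduct A σ := by
      set S : Finset (Site d) := Finset.univ.image z with hS
      set c : Site d → ℕ := fun b => (Finset.univ.filter fun i : Fin n => z i = b).card with hc
      refine ⟨S.filter fun b => Odd (c b), fun σ => ?_⟩
      rw [spinProduct, Finset.prod_filter,
        Finset.prod_comp (s := (Finset.univ : Finset (Fin n))) (fun b => spinAt b σ) z]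
      exact Finset.prod_congr rfl fun b _ => spinAt_pow_eq_ite b σ _
    simp_rw [hA]
    rw [show (∫ σ, spinProduct A σ ∂μ) = freeCorr d β 0 A from hcorr A]
    exact hasBoxLimit_isingCorr_free_holds (d := d) hβ le_rfl A
  -- the two-point function of `μ`
  have hS : ∀ a b, ∫ σ, spinAt a σ * spinAt b σ ∂μ = twoPointFree d β (b - a) := by
    intro a b
    rw [integral_spinAt_mul_spinAt_translate μ hTI a b]
    by_cases hv : b - a = 0
    · rw [hv, twoPointFree_zero]; simp
    · have hpair : ∀ σ, spinAt 0 σ * spinAt (b - a) σ = spinProduct {0, b - a} σ := fun σ => by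
        rw [spinProduct, Finset.prod_pair (Ne.symm hv)]
      simp_rw [hpair]
      change spinCorr μ {0, b - a} = _
      rw [hcorr, twoPointFree_eq_freeCorr β hv]
  -- base facts (theorems of the tree)
  have hgks : ∀ {Λ A : Finset (Site d)} {β h : ℝ} {bc : BoundaryCondition (Site d)},
      gks_one (zdGraph d) (Λ := Λ) (A := A) (β := β) (h := h) (bc := bc) :=
    GKSInequalities.gks_one_holds (zdGraph d)
  have hlim : hasBoxLimit_isingCorr_free d := hasBoxLimit_isingCorr_free_holds
  have hmono : isingCorr_free_mono_volume (d := d) := isingCorr_free_mono_volume_holds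
  have htr : isingTwoPoint_free_translate (d := d) := isingTwoPoint_free_translate_holds
  -- the right-hand side in terms of `twoPointFree`
  set P : Site d → ℝ := fun u => ∏ i, twoPoint μ spinAt u (x i) with hP
  have hPeq : ∀ u, P u = ∏ i, twoPointFree d β (x i - u) := fun u =>
    Finset.prod_congr rfl fun i _ => by
      change ∫ σ, spinAt u σ * spinAt (x i) σ ∂μ = _
      rw [hS]
  have hP0 : ∀ u, 0 ≤ P u := fun u => by
    rw [hPeq]; exact Finset.prod_nonneg fun i _ => twoPointFree_nonneg hlim hgks hβ _
  -- eventually all `x i` lie in the box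
  obtain ⟨L₀, hL₀⟩ := exists_forall_subset_box d (Finset.univ.image x)
  have hxbox : ∀ N, L₀ ≤ N → ∀ i, x i ∈ box d N := fun N hN i =>
    hL₀ N hN (Finset.mem_image_of_mem x (Finset.mem_univ i))
  -- termwise domination of the finite-volume products
  have hT0 : ∀ N, L₀ ≤ N → ∀ u ∈ box d N,
      0 ≤ ∏ j, isingTwoPoint (zdGraph d) (box d N) β 0 .free u (x j) := fun N hN u hu =>
    Finset.prod_nonneg fun j _ => isingTwoPoint_free_nonneg hgks hβ hu (hxbox N hN j)
  have hTP : ∀ N, L₀ ≤ N → ∀ u ∈ box d N,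
      ∏ j, isingTwoPoint (zdGraph d) (box d N) β 0 .free u (x j) ≤ P u := by
    intro N hN u hu
    rw [hPeq]
    refine Finset.prod_le_prod (fun j _ => isingTwoPoint_free_nonneg hgks hβ hu (hxbox N hN j))
      fun j _ => ?_
    exact isingTwoPoint_free_le_twoPointFree_sub hmono hlim htr hβ hu (hxbox N hN j)
  -- the bounding sequence and its limit
  set b : ℕ → ℝ := fun N => A * ∑' u, P u + E * ((∑' u, P u) - ∑ u ∈ box d (N - R), P u) with hb
  have hfin' : ∀ᶠ N : ℕ in atTop,
      |connectedFour (isingMeasure (zdGraph d) (box d N) β 0 .free) spinAt x| ≤ b N := by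
    filter_upwards [hfin, eventually_ge_atTop L₀] with N hN hNL
    refine hN.trans ?_
    have h1 : ∑ u ∈ box d N, ∏ j, isingTwoPoint (zdGraph d) (box d N) β 0 .free u (x j) ≤
        ∑' u, P u :=
      (Finset.sum_le_sum fun u hu => hTP N hNL u hu).trans (hsum.sum_le_tsum _ fun u _ => hP0 u)
    have h2 : ∑ u ∈ (box d N).filter (fun u => N - R < Site.supNorm u),
          ∏ j, isingTwoPoint (zdGraph d) (box d N) β 0 .free u (x j) ≤
        (∑' u, P u) - ∑ u ∈ box d (N - R), P u :=
      (Finset.sum_le_sum fun u hu => hTP N hNL u (Finset.mem_filter.1 hu).1).trans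
        (sum_filter_lt_supNorm_le_tsum_sub hP0 hsum N (N - R))
    show _ ≤ A * ∑' u, P u + E * ((∑' u, P u) - ∑ u ∈ box d (N - R), P u)
    exact add_le_add (mul_le_mul_of_nonneg_left h1 hA) (mul_le_mul_of_nonneg_left h2 hE)
  have hblim : Tendsto b atTop (𝓝 (A * ∑' u, P u + E * 0)) := by
    have h1 : Tendsto (fun N : ℕ => (∑' u, P u) - ∑ u ∈ box d (N - R), P u) atTop (𝓝 0) :=
      (tendsto_tsum_sub_sum_box_atTop hsum).comp (tendsto_sub_atTop_nat R)
    exact tendsto_const_nhds.add (h1.const_mul E)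
  rw [mul_zero, add_zero] at hblim
  -- the left-hand side converges
  have hconv : Tendsto (fun L : ℕ => connectedFour (isingMeasure (zdGraph d) (box d L) β 0 .free)
      spinAt x) atTop (𝓝 (connectedFour μ spinAt x)) := by
    have h4 := hmon x
    have h2 : ∀ a b : Site d, Tendsto (fun L : ℕ =>
        twoPoint (isingMeasure (zdGraph d) (box d L) β 0 .free) spinAt a b) atTop
        (𝓝 (twoPoint μ spinAt a b)) := by
      intro a b
      have h := hmon ![a, b]
      simp only [Fin.prod_univ_two, Matrix.cons_val_zero, Matrix.cons_val_one] at h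
      exact h
    simp only [connectedFour, nPoint]
    exact ((h4.sub ((h2 _ _).mul (h2 _ _))).sub ((h2 _ _).mul (h2 _ _))).sub
      ((h2 _ _).mul (h2 _ _))
  -- conclusion
  exact le_of_tendsto_of_tendsto hconv.abs hblim hfin'

/-- **Thermodynamic limit of a four-point bound with a vanishing boundary layer, at a point of
uniqueness**: as `abs_connectedFour_le_of_finiteVolume_free`, for every `μ ∈ 𝒢(β, 0)` when
`|𝒢(β, 0)| = 1` (then `μ` is the translation-invariant free state, `exists_freeMeasure_holds`).
[cite: AizenmanDuminilCopinAnnals2021, arXiv:1912.07973 §3.2, (3.4)–(3.5) with footnote 5 (p. 9), and §4.1/§6.1, proof of Thm 1.3] -/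
theorem abs_connectedFour_le_of_finiteVolume_of_hasUniqueGibbsMeasure {β : ℝ} (hβ : 0 ≤ β)
    (huniq : HasUniqueGibbsMeasure (isingSpecification (zdGraph d) β 0))
    (μ : Measure (SpinConfig (Site d))) (hμ : μ ∈ isingGibbsMeasures d β 0)
    (x : Fin 4 → Site d) {A E : ℝ} (hA : 0 ≤ A) (hE : 0 ≤ E) (R : ℕ)
    (hfin : ∀ᶠ N : ℕ in atTop,
      |connectedFour (isingMeasure (zdGraph d) (box d N) β 0 .free) spinAt x| ≤
        A * ∑ u ∈ box d N, ∏ j, isingTwoPoint (zdGraph d) (box d N) β 0 .free u (x j) +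
        E * ∑ u ∈ (box d N).filter (fun u => N - R < Site.supNorm u),
              ∏ j, isingTwoPoint (zdGraph d) (box d N) β 0 .free u (x j))
    (hsum : Summable fun u : Site d => ∏ i, twoPoint μ spinAt u (x i)) :
    |connectedFour μ spinAt x| ≤ A * ∑' u : Site d, ∏ i, twoPoint μ spinAt u (x i) := by
  obtain ⟨μf, hμf, hTI, hcorr⟩ := exists_freeMeasure_holds d (β := β) 0 hβ le_rfl
  have hμeq : μ = μf := huniq.1 hμ hμf
  subst hμeq
  haveI : IsProbabilityMeasure μ := hμ.1
  exact abs_connectedFour_le_of_finiteVolume_free hβ μ hTI hcorr x hA hE R hfin hsum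

/-- **Thermodynamic limit of a four-point bound with a vanishing boundary layer, `d ≥ 3`,
`0 ≤ β ≤ β_c`**: as `abs_connectedFour_le_of_finiteVolume_free`, for every `μ ∈ 𝒢(β, 0)`;
uniqueness of `𝒢(β, 0)` is the tree's `hasUniqueGibbsMeasure_of_lt_criticalBeta_holds`
(Lebowitz–Martin-Löf) below `β_c` and `hasUniqueGibbsMeasure_criticalBeta_holds`
(Aizenman–Duminil-Copin–Sidoravicius 2015) at `β_c`. [cite: AizenmanDuminilCopinAnnals2021, arXiv:1912.07973 §3.2, (3.4)–(3.5) with footnote 5 (p. 9), and §4.1/§6.1, proof of Thm 1.3] -/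
theorem abs_connectedFour_le_of_finiteVolume_three_le (hd : 3 ≤ d) {β : ℝ} (hβ : 0 ≤ β)
    (hβc : β ≤ criticalBeta d)
    (μ : Measure (SpinConfig (Site d))) (hμ : μ ∈ isingGibbsMeasures d β 0)
    (x : Fin 4 → Site d) {A E : ℝ} (hA : 0 ≤ A) (hE : 0 ≤ E) (R : ℕ)
    (hfin : ∀ᶠ N : ℕ in atTop,
      |connectedFour (isingMeasure (zdGraph d) (box d N) β 0 .free) spinAt x| ≤
        A * ∑ u ∈ box d N, ∏ j, isingTwoPoint (zdGraph d) (box d N) β 0 .free u (x j) +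
        E * ∑ u ∈ (box d N).filter (fun u => N - R < Site.supNorm u),
              ∏ j, isingTwoPoint (zdGraph d) (box d N) β 0 .free u (x j))
    (hsum : Summable fun u : Site d => ∏ i, twoPoint μ spinAt u (x i)) :
    |connectedFour μ spinAt x| ≤ A * ∑' u : Site d, ∏ i, twoPoint μ spinAt u (x i) := by
  have huniq : HasUniqueGibbsMeasure (isingSpecification (zdGraph d) β 0) := by
    rcases hβc.lt_or_eq with hlt | heq
    · exact hasUniqueGibbsMeasure_of_lt_criticalBeta_holds (by omega) hβ hlt
    · rw [heq]; exact hasUniqueGibbsMeasure_criticalBeta_holds hd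
  exact abs_connectedFour_le_of_finiteVolume_of_hasUniqueGibbsMeasure hβ huniq μ hμ x hA hE R
    hfin hsum

/-! ### Part 2. Theorem 1.3 from its finite-volume bulk form -/

/-- The two-point function `⟨σ₀σ_v⟩_μ` of `μ ∈ 𝒢(β, 0)` on `ℤ⁴`, `0 ≤ β ≤ β_c`, is the free
two-point function `⟨σ₀σ_v⟩^∅_β` (uniqueness below and at `β_c`, and the free state; theorems of
the tree), and `μ` is a probability measure. [cite: FriedliVelenik2017, Thm. 3.28 and Exercise 3.16] -/
theorem twoPoint_spinAt_eq_twoPointFree_four {β : ℝ} (hβ : 0 ≤ β) (hβc : β ≤ criticalBeta 4)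
    {μ : Measure (SpinConfig (Site 4))} (hμ : μ ∈ isingGibbsMeasures 4 β 0) :
    IsProbabilityMeasure μ ∧ ∀ a b, twoPoint μ spinAt a b = twoPointFree 4 β (b - a) :=
  isingGibbsMeasure_twoPoint_of_facts hasUniqueGibbsMeasure_of_lt_criticalBeta_holds
    hasUniqueGibbsMeasure_criticalBeta_holds (fun d => exists_freeMeasure_holds d 0) (by norm_num)
    hβ hβc hμ

/-- `1 ≤ B_L ≤ |Λ_L|` for the bubble diagram of a two-point function `0 ≤ S ≤ 1` with `S(0) = 1`
and `L ≥ 0`. [folklore] -/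
theorem one_le_bubbleDiagram_and_le_card {S : Site d → ℝ} (hS0 : ∀ v, 0 ≤ S v) (hS1 : ∀ v, S v ≤ 1)
    (h0 : S 0 = 1) {L : ℝ} (hL : 0 ≤ L) :
    1 ≤ bubbleDiagram S L ∧ bubbleDiagram S L ≤ #(latticeBox d L) := by
  refine ⟨one_le_bubbleDiagram h0 hL, ?_⟩
  rw [bubbleDiagram]
  calc ∑ x ∈ latticeBox d L, S x ^ 2 ≤ ∑ _x ∈ latticeBox d L, (1 : ℝ) :=
        Finset.sum_le_sum fun x _ => by
          calc S x ^ 2 = S x * S x := sq _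
            _ ≤ 1 * 1 := mul_le_mul (hS1 x) (hS1 x) (hS0 x) zero_le_one
            _ = 1 := mul_one _
    _ = #(latticeBox d L) := by rw [Finset.sum_const, nsmul_eq_mul, mul_one]

/-- **Aizenman–Duminil-Copin 2021, Theorem 1.3, from its finite-volume bulk form.** Suppose there
are `c, C > 0` and `L₀` such that for every `0 ≤ β ≤ β_c(4)`, every `L ≥ L₀` in the window
`L ≤ ξ(β)` (`β = β_c`, or `0 < β` and `L ξ(β)⁻¹ ≤ 1`), and every `x₁,…,x₄ ∈ ℤ⁴` at mutual
sup-distance `> L`, there are a boundary-layer width `R` and a constant `E ≥ 0` such that for all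
large `N` the free state of the box `Λ_N` satisfies
`|U₄^{Λ_N}(x)| ≤ (C / B_L(β)^c) ∑_{u ∈ Λ_N} ∏ⱼ ⟨σ_uσ_{xⱼ}⟩_{Λ_N} + E ∑_{u ∈ Λ_N, ‖u‖_∞ > N-R} ∏ⱼ ⟨σ_uσ_{xⱼ}⟩_{Λ_N}`,
`B_L(β) = ∑_{v ∈ Λ_L} (⟨σ₀σ_v⟩^∅_β)²` the infinite-volume bubble diagram. Then the improved tree
diagram bound `aizenmanDuminilCopin_improvedTreeDiagramBound` holds (for the DLR states, all
`L > 0`, with exponent `c`): for `L ≥ max(L₀, 1)` by the thermodynamic limit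
`abs_connectedFour_le_of_finiteVolume_three_le` (`⟨σ₀σ_v⟩_μ = ⟨σ₀σ_v⟩^∅_β`), and for
`0 < L < max(L₀, 1)` by the plain tree diagram bound `|U₄| ≤ 2 ∑_u ∏ⱼ ⟨σ_uσ_{xⱼ}⟩`
(`aizenman_treeDiagramBound_three_le`) and `B_L ≤ |Λ_{max(L₀,1)}|`, the constant being
`max(C, 2 |Λ_{max(L₀,1)}|^c)`. This is the form in which the finite-graph random-current line
(§4.1 reduction `Current.ursellInter_mul_sq_le` + the intersection-clustering bound in the bulk)
delivers Theorem 1.3. [cite: AizenmanDuminilCopinAnnals2021, arXiv:1912.07973 Theorem 1.3 (p. 6); proof §4.1 and §6.1 (p. 21)] -/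
theorem aizenmanDuminilCopin_improvedTreeDiagramBound_of_finiteVolume
    (h : ∃ c C L₀ : ℝ, 0 < c ∧ 0 < C ∧
      ∀ (β L : ℝ), 0 ≤ β → β ≤ criticalBeta 4 → L₀ ≤ L →
        (β = criticalBeta 4 ∨ (0 < β ∧ L * invCorrLength (twoPointPlus 4 β) ≤ 1)) →
      ∀ x : Fin 4 → Site 4, (∀ i j, i ≠ j → L < ‖x i - x j‖) →
      ∃ (R : ℕ) (E : ℝ), 0 ≤ E ∧ ∀ᶠ N : ℕ in atTop,
        |connectedFour (isingMeasure (zdGraph 4) (box 4 N) β 0 .free) spinAt x| ≤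
          C / bubbleDiagram (twoPointFree 4 β) L ^ c *
              ∑ u ∈ box 4 N, ∏ j, isingTwoPoint (zdGraph 4) (box 4 N) β 0 .free u (x j) +
          E * ∑ u ∈ (box 4 N).filter (fun u => N - R < Site.supNorm u),
              ∏ j, isingTwoPoint (zdGraph 4) (box 4 N) β 0 .free u (x j)) :
    aizenmanDuminilCopin_improvedTreeDiagramBound := by
  obtain ⟨c, C, L₀, hc, hC, H⟩ := h
  set L₁ : ℝ := max L₀ 1 with hL₁
  set M : ℝ := ((#(latticeBox 4 L₁) : ℕ) : ℝ) with hM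
  have hL₁1 : 1 ≤ L₁ := le_max_right _ _
  have hM1 : 1 ≤ M := by
    rw [hM]
    have h0 : (0 : Site 4) ∈ latticeBox 4 L₁ := zero_mem_latticeBox (zero_le_one.trans hL₁1)
    exact_mod_cast Finset.card_pos.2 ⟨0, h0⟩
  have hMc : 0 < M ^ c := Real.rpow_pos_of_pos (zero_lt_one.trans_le hM1) c
  refine ⟨c, max C (2 * M ^ c), hc, lt_max_of_lt_left hC, ?_⟩
  intro β L hβ hβc hL hwin μ hμ x hsep hsum
  obtain ⟨hprob, htwo⟩ := twoPoint_spinAt_eq_twoPointFree_four hβ hβc hμ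
  haveI := hprob
  -- the two-point function of `μ` is `twoPointFree 4 β`
  have hS0 : twoPoint μ spinAt 0 = twoPointFree 4 β := by
    funext v
    rw [htwo, sub_zero]
  have hgks : ∀ {Λ A : Finset (Site 4)} {β h : ℝ} {bc : BoundaryCondition (Site 4)},
      gks_one (zdGraph 4) (Λ := Λ) (A := A) (β := β) (h := h) (bc := bc) :=
    GKSInequalities.gks_one_holds (zdGraph 4)
  have hF0 : ∀ v, 0 ≤ twoPointFree 4 β v := fun v =>
    twoPointFree_nonneg hasBoxLimit_isingCorr_free_holds hgks hβ v
  have hF1 : ∀ v, twoPointFree 4 β v ≤ 1 := fun v =>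
    twoPointFn_le_one μ (S := twoPointFree 4 β) (fun a b => htwo a b) v
  have hF00 : twoPointFree 4 β 0 = 1 := twoPointFree_zero 4 β
  obtain ⟨hB1, -⟩ := one_le_bubbleDiagram_and_le_card hF0 hF1 hF00 hL.le
  have hBpos : 0 < bubbleDiagram (twoPointFree 4 β) L := zero_lt_one.trans_le hB1
  have hBc : 0 < bubbleDiagram (twoPointFree 4 β) L ^ c := Real.rpow_pos_of_pos hBpos c
  have htsum0 : 0 ≤ ∑' u : Site 4, ∏ i, twoPoint μ spinAt u (x i) :=
    tsum_nonneg fun u => Finset.prod_nonneg fun i _ => by rw [htwo]; exact hF0 _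
  rw [hS0]
  by_cases hLL : L₁ ≤ L
  · -- large scales: the finite-volume bulk bound and the thermodynamic limit
    obtain ⟨R, E, hE, hev⟩ := H β L hβ hβc ((le_max_left _ _).trans hLL) hwin x hsep
    have key := abs_connectedFour_le_of_finiteVolume_three_le (d := 4) (by norm_num) hβ hβc μ hμ x
      (A := C / bubbleDiagram (twoPointFree 4 β) L ^ c) (div_nonneg hC.le hBc.le) hE R hev hsum
    refine key.trans ?_
    gcongr
    exact le_max_left _ _
  · -- small scales: the plain tree diagram bound and `B_L ≤ |Λ_{L₁}|`
    push Not at hLL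
    have hsum' : Summable fun u : Site 4 => ∏ i, ∫ σ, spinAt (x i) σ * spinAt u σ ∂μ := by
      refine hsum.congr fun u => Finset.prod_congr rfl fun i _ => ?_
      exact twoPoint_comm μ spinAt u (x i)
    have hplain := aizenman_treeDiagramBound_three_le (d := 4) (by norm_num) β hβ hβc μ hμ x hsum'
    have heq : (∑' u : Site 4, ∏ i, ∫ σ, spinAt (x i) σ * spinAt u σ ∂μ) =
        ∑' u : Site 4, ∏ i, twoPoint μ spinAt u (x i) :=
      tsum_congr fun u => Finset.prod_congr rfl fun i _ => (twoPoint_comm μ spinAt u (x i)).symm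
    rw [heq] at hplain
    refine hplain.trans ?_
    have hBM : bubbleDiagram (twoPointFree 4 β) L ≤ M := by
      obtain ⟨-, hBcard⟩ := one_le_bubbleDiagram_and_le_card hF0 hF1 hF00 hL.le
      refine hBcard.trans ?_
      rw [hM]
      exact_mod_cast Finset.card_le_card (latticeBox_mono hLL.le)
    have hBMc : bubbleDiagram (twoPointFree 4 β) L ^ c ≤ M ^ c :=
      Real.rpow_le_rpow hBpos.le hBM hc.le
    have h2 : (2 : ℝ) ≤ max C (2 * M ^ c) / bubbleDiagram (twoPointFree 4 β) L ^ c := by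
      rw [le_div_iff₀ hBc]
      calc 2 * bubbleDiagram (twoPointFree 4 β) L ^ c ≤ 2 * M ^ c := by gcongr
        _ ≤ max C (2 * M ^ c) := le_max_right _ _
    exact mul_le_mul_of_nonneg_right h2 htsum0

end Literature.Probability.LatticeModels
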